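import Literature.Computability.Cryptography.TreeSigSpec
import Literature.Computability.Complexity.FoldBricks
import HarnessLib

/-!
# The memoryless authentication-tree signature scheme, II: the algorithms are polynomial-time

Topic `Literature/Computability/Cryptography`; companion of `TreeSigSpec.lean` (Goldreich 2004, Construction
6.4.16 as `TreeSig.scheme P`, correctness). Here the three algorithms are written in the `FP` string algebra
(`BrickAlgebra.lean`, `ListBricks.lean`, `FoldBricks.lean`) and the scheme is shown to be EFFICIENT
(`SignatureScheme.IsEfficient`) when the one-time scheme `S` and the function ensemble `F` are:

* `TreeSig.chainG pkN sgN α pre σ` — the items of a signature below the node `pre` written against an abstract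
  NODE INTERFACE (`pkN L` = the verification key of node `L`, `sgN L m` = the one-time signature of `m` at node
  `L`); `chain_eq_chainG` identifies the block-based `chain` of the specification with the instance
  `pkN = pkOf ∘ blk`, `sgN L = signOf (blk L)`. The interface is what the security reductions program against
  (their node keys come from tables and, at one planted node, from outside).
* `TreeSig.chainFn pkF sgF Pc` — ONE clocked loop over the leaf bits computing
  `⟨⟨prm, α⟩, σ⟩ ↦ code (σ, chainG …)` for node functions given as string functions `pkF ⟨prm, L⟩`,
  `sgF ⟨prm, ⟨L, m⟩⟩`; `chainFn_mem_FP` (for `pkF, sgF ∈ FP`; pieces clipped to the polynomial `Pc` of the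
  yardstick, `clipP`) and the semantics `chainFn_apply` (exact whenever the genuine pieces are shorter than the
  clip).
* The instance of the scheme: `blkF`, `pkF₀`, `sgF₀` (`F`, `G`, `S` composed as bricks), `signT_isPolyTime`;
  `keyGenT_isPolyTime`; the verifier's walk `verLoop`/`verFnT` and `verifyT_polyTime`; **`TreeSig.isEfficient`**.

All statements proved; no named facts.

## References

* O. Goldreich, *Foundations of Cryptography II: Basic Applications*, CUP 2004, §6.4.2.2–6.4.2.3
  (Constructions 6.4.14, 6.4.16: "`G'`, `S'`, `V'` are polynomial-time").
* S. Arora, B. Barak, *Computational Complexity: A Modern Approach*, CUP 2009, §1.3 (bounded loops compose).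
-/

namespace Literature.Computability.Cryptography

open _root_.Computability Complexity Complexity.Brick Polynomial
open Complexity.Plumb Complexity.OracleCompose Complexity.HashBricks

namespace TreeSig

/-! ### The chain against an abstract node interface -/

section ChainG

variable (pkN : List Bool → List Bool) (sgN : List Bool → List Bool → List Bool)

/-- The items of the authentication path below the node `pre` along the leaf bits `σ`, against the node
interface `(pkN, sgN)`: per level the keys of the two children and the one-time signature, at the parent, of
their pair code. [Goldreich 2004, Construction 6.4.14 (signing, steps 2–3)] [cite: Goldreich2004, Construction 6.4.14] -/
def chainItems : List Bool → List Bool → List (List Bool)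
  | _, [] => []
  | pre, b :: σ =>
    pkN (pre ++ [false]) :: pkN (pre ++ [true]) :: sgN pre (boolPair (pkN (pre ++ [false])) (pkN (pre ++ [true]))) ::
      chainItems (pre ++ [b]) σ

/-- The full chain: the path items followed by the one-time signature of the document at the leaf `pre σ`.
[Goldreich 2004, Construction 6.4.14 (signing, steps 2–4)] [cite: Goldreich2004, Construction 6.4.14] -/
def chainG (α pre σ : List Bool) : List (List Bool) := chainItems pkN sgN pre σ ++ [sgN (pre ++ σ) α]

/-- `chainItems` has `3|σ|` items. [folklore] -/
theorem length_chainItems : ∀ pre σ : List Bool, (chainItems pkN sgN pre σ).length = 3 * σ.length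
  | _, [] => rfl
  | pre, b :: σ => by simp only [chainItems, List.length_cons, length_chainItems (pre ++ [b]) σ]; omega

/-- Appending one more level. [folklore] -/
theorem chainItems_append_singleton : ∀ (pre σ : List Bool) (b : Bool),
    chainItems pkN sgN pre (σ ++ [b]) = chainItems pkN sgN pre σ ++
      [pkN (pre ++ σ ++ [false]), pkN (pre ++ σ ++ [true]),
        sgN (pre ++ σ) (boolPair (pkN (pre ++ σ ++ [false])) (pkN (pre ++ σ ++ [true])))]
  | pre, [], b => by simp [chainItems]
  | pre, c :: σ, b => by
    rw [List.cons_append, chainItems, chainItems, chainItems_append_singleton (pre ++ [c]) σ b]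
    simp

variable (P : Spec)

/-- **The block-based chain is the abstract chain** for the interface read off a block assignment `G`:
`pkN = pkOf ∘ G`, `sgN L = signOf (G L)`, the children blocks being those of `pathLabelsFrom pre σ`.
[Goldreich 2004, Construction 6.4.16] [folklore] -/
theorem chain_eq_chainG (n : ℕ) (G : List Bool → List Bool) (α : List Bool) : ∀ pre σ : List Bool,
    chain P n α (G pre) σ ((pathLabelsFrom pre σ).map G) =
      chainG (fun L => pkOf P n (G L)) (fun L m => signOf P n (G L) m) α pre σ
  | pre, [] => by simp [chain, chainG, chainItems]
  | pre, b :: σ => by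
    rw [pathLabelsFrom, List.map_cons, List.map_cons, chain, chainG, chainItems]
    simp only [List.getD_cons_zero, List.getD_cons_succ, List.drop_succ_cons, List.drop_zero, List.cons_append,
      List.cons.injEq, true_and]
    have h := chain_eq_chainG n G α (pre ++ [b]) σ
    rw [chainG, List.append_assoc, List.singleton_append] at h
    cases b <;> simpa using h

end ChainG

/-! ### Coded lists: append, clipping to a polynomial -/

/-- `encList (l₁ ++ l₂) = encList l₁ ++ encList l₂`. [folklore] -/
theorem encList_append (l₁ l₂ : List (List Bool)) : encList (l₁ ++ l₂) = encList l₁ ++ encList l₂ := by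
  induction l₁ with
  | nil => simp
  | cons a l₁ ih => rw [List.cons_append, encList_cons, encList_cons, ih]; simp [boolPair]

/-- `encList [a] = ⟨a, ε⟩`. [folklore] -/
theorem encList_singleton (a : List Bool) : encList [a] = boolPair a [] := rfl

/-- `clipP Q f z = (f z) ↾ Q(|fstF z|)`: the output of `f` clipped to a polynomial of the first field.
[folklore] -/
noncomputable def clipP (Q : Polynomial ℕ) (f : List Bool → List Bool) : List Bool → List Bool :=
  takeFn ∘ fanoutFn (polyFn Q ∘ fstF) f

/-- Value of `clipP`. [folklore] -/
theorem clipP_apply (Q : Polynomial ℕ) (f : List Bool → List Bool) (z : List Bool) :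
    clipP Q f z = (f z).take (Q.eval (fstF z).length) := by
  simp [clipP]

/-- The clipped function is short, on every input. [folklore] -/
theorem length_clipP_le (Q : Polynomial ℕ) (f : List Bool → List Bool) (z : List Bool) :
    (clipP Q f z).length ≤ Q.eval (fstF z).length := by
  rw [clipP_apply, List.length_take]; exact min_le_left _ _

/-- Clipping is the identity on short outputs. [folklore] -/
theorem clipP_eq_self {Q : Polynomial ℕ} {f : List Bool → List Bool} {z : List Bool} (h : (f z).length ≤ Q.eval (fstF z).length) :
    clipP Q f z = f z := by
  rw [clipP_apply, List.take_of_length_le h]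

/-- `clipP Q f ∈ FP`. [folklore] -/
theorem clipP_mem_FP (Q : Polynomial ℕ) {f : List Bool → List Bool} (hf : f ∈ FP) : clipP Q f ∈ FP :=
  comp_mem_FP takeFn_mem_FP (fanoutFn_mem_FP (comp_mem_FP (polyFn_mem_FP Q) fstF_mem_FP) hf)

/-- An `FP` function has polynomially bounded output length. [Arora–Barak 2009, §1.3] [folklore] -/
theorem exists_poly_length_le_of_mem_FP' {f : List Bool → List Bool} (hf : f ∈ FP) :
    ∃ s : Polynomial ℕ, ∀ x, (f x).length ≤ s.eval x.length := by
  obtain ⟨p, M, hM⟩ := hf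
  refine ⟨X + C (TM2Comp.machinePushBound M.tm) * p, fun x => ?_⟩
  have h := (hM x).length_le
  simpa using h

/-! ### The chain loop -/

section Loop

variable (pkF sgF : List Bool → List Bool) (Pc : Polynomial ℕ)

/-- The parameters `prm` read off a loop record `z = ⟨⟨prm, α⟩, ⟨cnt, ⟨σ', ⟨pre, acc⟩⟩⟩⟩`. [folklore] -/
noncomputable def prmZ : List Bool → List Bool := fstF ∘ nthF 0
/-- The left child label `pre 0`. [folklore] -/
noncomputable def lab0 : List Bool → List Bool := fun z => nthF 3 z ++ [false]
/-- The right child label `pre 1`. [folklore] -/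
noncomputable def lab1 : List Bool → List Bool := fun z => nthF 3 z ++ [true]
/-- The key of the left child. [folklore] -/
noncomputable def pk0Z : List Bool → List Bool := pkF ∘ fanoutFn prmZ lab0
/-- The key of the right child. [folklore] -/
noncomputable def pk1Z : List Bool → List Bool := pkF ∘ fanoutFn prmZ lab1
/-- The one-time signature, at the current node `pre`, of the pair code of the children keys. [folklore] -/
noncomputable def sgZ : List Bool → List Bool :=
  sgF ∘ fanoutFn prmZ (fanoutFn (nthF 3) (fanoutFn (pk0Z pkF) (pk1Z pkF)))
/-- The coded piece `pk₀, pk₁, β` appended in one round. [folklore] -/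
noncomputable def pieceZ : List Bool → List Bool :=
  fanoutFn (pk0Z pkF) (fanoutFn (pk1Z pkF) (fanoutFn (sgZ pkF sgF) fun _ => []))

/-- **The loop body**: state `⟨σ', ⟨pre, acc⟩⟩ ↦ ⟨tail σ', ⟨pre (head σ'), acc ++ piece⟩⟩` (piece clipped).
[Goldreich 2004, Construction 6.4.14 (signing: one level of the path)] [cite: Goldreich2004, Construction 6.4.14] -/
noncomputable def chainBody : List Bool → List Bool :=
  fanoutFn (dropFn ∘ fanoutFn (fun _ => [true]) (nthF 2))
    (fanoutFn (fun z => nthF 3 z ++ take1Fn (nthF 2 z)) (fun z => sndPow 3 z ++ clipP Pc (pieceZ pkF sgF) z))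

/-- `pieceZ` on a loop record. [folklore] -/
theorem pieceZ_apply (x cnt σ' pre acc : List Bool) :
    pieceZ pkF sgF (boolPair x (boolPair cnt (boolPair σ' (boolPair pre acc)))) =
      encList [pkF (boolPair (fstF x) (pre ++ [false])), pkF (boolPair (fstF x) (pre ++ [true])),
        sgF (boolPair (fstF x) (boolPair pre (boolPair (pkF (boolPair (fstF x) (pre ++ [false])))
          (pkF (boolPair (fstF x) (pre ++ [true]))))))] := by
  simp [pieceZ, pk0Z, pk1Z, sgZ, prmZ, lab0, lab1, nthF, encList_cons]

/-- The loop body on a loop record with a nonempty bit source. [folklore] -/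
theorem chainBody_apply (x cnt pre acc : List Bool) (b : Bool) (σ' : List Bool) :
    chainBody pkF sgF Pc (boolPair x (boolPair cnt (boolPair (b :: σ') (boolPair pre acc)))) =
      boolPair σ' (boolPair (pre ++ [b])
        (acc ++ clipP Pc (pieceZ pkF sgF) (boolPair x (boolPair cnt (boolPair (b :: σ') (boolPair pre acc)))))) := by
  simp [chainBody, nthF, sndPow, take1Fn]

/-- `pieceZ ∈ FP`. [folklore] -/
theorem pieceZ_mem_FP (hpk : pkF ∈ FP) (hsg : sgF ∈ FP) : pieceZ pkF sgF ∈ FP := by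
  have hprm : prmZ ∈ FP := comp_mem_FP fstF_mem_FP (nthF_mem_FP 0)
  have h0 : pk0Z pkF ∈ FP := comp_mem_FP hpk (fanoutFn_mem_FP hprm (append_mem_FP (nthF_mem_FP 3) (const_mem_FP _)))
  have h1 : pk1Z pkF ∈ FP := comp_mem_FP hpk (fanoutFn_mem_FP hprm (append_mem_FP (nthF_mem_FP 3) (const_mem_FP _)))
  exact fanoutFn_mem_FP h0 (fanoutFn_mem_FP h1 (fanoutFn_mem_FP
    (comp_mem_FP hsg (fanoutFn_mem_FP hprm (fanoutFn_mem_FP (nthF_mem_FP 3) (fanoutFn_mem_FP h0 h1)))) (const_mem_FP _)))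

/-- `chainBody ∈ FP`. [folklore] -/
theorem chainBody_mem_FP (hpk : pkF ∈ FP) (hsg : sgF ∈ FP) : chainBody pkF sgF Pc ∈ FP :=
  fanoutFn_mem_FP (comp_mem_FP dropFn_mem_FP (fanoutFn_mem_FP (const_mem_FP _) (nthF_mem_FP 2)))
    (fanoutFn_mem_FP (append_mem_FP (nthF_mem_FP 3) (comp_mem_FP take1Fn_mem_FP (nthF_mem_FP 2)))
      (append_mem_FP (sndPow_mem_FP 3) (clipP_mem_FP Pc (pieceZ_mem_FP pkF sgF hpk hsg))))

/-- **Growth of the loop body**: `≤ |state| + Pc(|x|) + 8` on every record. [folklore] -/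
theorem length_chainBody_le (z : List Bool) :
    (chainBody pkF sgF Pc z).length ≤ (sndPow 1 z).length + (Pc + 8).eval (fstF z).length := by
  have h1 : 2 * (nthF 2 z).length + (sndPow 2 z).length ≤ (sndPow 1 z).length := length_nthF_succ_add_sndPow_succ_le 1 z
  have h2 : 2 * (nthF 3 z).length + (sndPow 3 z).length ≤ (sndPow 2 z).length := length_nthF_succ_add_sndPow_succ_le 2 z
  have hc := length_clipP_le Pc (pieceZ pkF sgF) z
  have ht : (take1Fn (nthF 2 z)).length ≤ 1 := by
    simp only [take1Fn, List.length_take]; exact min_le_left _ _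
  have hd : (dropFn (fanoutFn (fun _ => [true]) (nthF 2) z)).length ≤ (nthF 2 z).length := by
    rw [fanoutFn_apply, dropFn_boolPair]; simp
  have hlen : (chainBody pkF sgF Pc z).length = 2 * (dropFn (fanoutFn (fun _ => [true]) (nthF 2) z)).length + 2 +
      (2 * ((nthF 3 z).length + (take1Fn (nthF 2 z)).length) + 2 + ((sndPow 3 z).length + (clipP Pc (pieceZ pkF sgF) z).length)) := by
    simp only [chainBody, fanoutFn_apply, Function.comp_apply, length_boolPair, List.length_append]
  rw [hlen, eval_add, eval_ofNat]
  omega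

/-- **The loop computes the chain items**: from state `⟨σ, ⟨pre, acc⟩⟩`, `|σ|` rounds end in state
`⟨ε, ⟨pre σ, acc ++ code (chainItems …)⟩⟩`, provided every genuine piece is shorter than the clip.
[Goldreich 2004, Construction 6.4.14 (signing loop)] [folklore] -/
theorem loopModel_chainBody (x : List Bool)
    (hshort : ∀ (cnt σ' pre acc : List Bool), pre.length + σ'.length ≤ x.length →
      (pieceZ pkF sgF (boolPair x (boolPair cnt (boolPair σ' (boolPair pre acc))))).length ≤ Pc.eval x.length) :
    ∀ (σ pre acc : List Bool), pre.length + σ.length ≤ x.length →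
    loopModel (chainBody pkF sgF Pc) x σ.length (boolPair σ (boolPair pre acc)) =
      boolPair [] (boolPair (pre ++ σ) (acc ++ encList (chainItems (fun L => pkF (boolPair (fstF x) L))
        (fun L m => sgF (boolPair (fstF x) (boolPair L m))) pre σ)))
  | [], pre, acc, _ => by simp [loopModel, chainItems]
  | b :: σ, pre, acc, hle => by
    rw [List.length_cons, loopModel, chainBody_apply, clipP_eq_self (by rw [fstF_boolPair]; exact hshort _ _ _ _ hle), pieceZ_apply,
      loopModel_chainBody x hshort σ (pre ++ [b]) _ (by simp only [List.length_append, List.length_cons, List.length_nil] at hle ⊢; omega),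
      chainItems, List.append_assoc, List.append_assoc, ← encList_append]
    rfl

/-- The initial loop record `⟨x, ⟨bin |σ|, ⟨σ, ⟨ε, ε⟩⟩⟩⟩` from `w = ⟨x, σ⟩`. [folklore] -/
noncomputable def chainInit : List Bool → List Bool :=
  fanoutFn fstF (fanoutFn (lenBinF ∘ sndF) (fanoutFn sndF fun _ => boolPair [] []))

/-- The loop run on `w = ⟨x, σ⟩`. [folklore] -/
noncomputable def chainRun : List Bool → List Bool := loopX (chainBody pkF sgF Pc) ∘ chainInit

/-- **The signing function against a node interface**: `⟨⟨prm, α⟩, σ⟩ ↦ code (σ, chainG …)` — the loop, then the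
leaf signature of `α`. [Goldreich 2004, Construction 6.4.14 (signing)] [cite: Goldreich2004, Construction 6.4.14] -/
noncomputable def chainFn : List Bool → List Bool :=
  fanoutFn sndF (appF ∘ fanoutFn (sndPow 3 ∘ chainRun pkF sgF Pc)
    (fanoutFn (sgF ∘ fanoutFn (fstF ∘ fstF) (fanoutFn (nthF 3 ∘ chainRun pkF sgF Pc) (sndF ∘ fstF))) fun _ => []))

/-- `chainInit ∈ FP`. [folklore] -/
theorem chainInit_mem_FP : chainInit ∈ FP :=
  fanoutFn_mem_FP fstF_mem_FP (fanoutFn_mem_FP (comp_mem_FP lenBinF_mem_FP sndF_mem_FP) (fanoutFn_mem_FP sndF_mem_FP (const_mem_FP _)))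

/-- The loop is in `FP`. [folklore] -/
theorem loopX_chainBody_mem_FP (hpk : pkF ∈ FP) (hsg : sgF ∈ FP) : loopX (chainBody pkF sgF Pc) ∈ FP := by
  have hb : chainBody pkF sgF Pc ∈ FP := chainBody_mem_FP pkF sgF Pc hpk hsg
  have hg : ∀ z, (chainBody pkF sgF Pc z).length ≤ (sndPow 1 z).length + (Pc + 8).eval (fstF z).length :=
    length_chainBody_le pkF sgF Pc
  exact loopX_mem_FP hb hg

/-- `chainRun ∈ FP`. [folklore] -/
theorem chainRun_mem_FP (hpk : pkF ∈ FP) (hsg : sgF ∈ FP) : chainRun pkF sgF Pc ∈ FP :=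
  comp_mem_FP (loopX_chainBody_mem_FP pkF sgF Pc hpk hsg) chainInit_mem_FP

/-- `chainFn ∈ FP` for node functions in `FP`. [Arora–Barak 2009, §1.3] [folklore] -/
theorem chainFn_mem_FP (hpk : pkF ∈ FP) (hsg : sgF ∈ FP) : chainFn pkF sgF Pc ∈ FP := by
  have hrun : chainRun pkF sgF Pc ∈ FP := chainRun_mem_FP pkF sgF Pc hpk hsg
  exact fanoutFn_mem_FP sndF_mem_FP (comp_mem_FP appF_mem_FP (fanoutFn_mem_FP (comp_mem_FP (sndPow_mem_FP 3) hrun)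
    (fanoutFn_mem_FP (comp_mem_FP hsg (fanoutFn_mem_FP (comp_mem_FP fstF_mem_FP fstF_mem_FP)
      (fanoutFn_mem_FP (comp_mem_FP (nthF_mem_FP 3) hrun) (comp_mem_FP sndF_mem_FP fstF_mem_FP)))) (const_mem_FP _))))

/-- **Semantics of `chainFn`**: on `⟨x, σ⟩` with `x = ⟨prm, α⟩` and `|σ| ≤ |x|`, if the genuine pieces are shorter
than the clip, the value is `code (σ, chainG pkN sgN α ε σ)` for the node interface `pkN L = pkF ⟨prm, L⟩`,
`sgN L m = sgF ⟨prm, ⟨L, m⟩⟩`. [Goldreich 2004, Construction 6.4.14] [folklore] -/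
theorem chainFn_apply (prm α σ : List Bool) (hσ : σ.length ≤ (boolPair prm α).length)
    (hshort : ∀ (cnt σ' pre acc : List Bool), pre.length + σ'.length ≤ (boolPair prm α).length →
      (pieceZ pkF sgF (boolPair (boolPair prm α) (boolPair cnt (boolPair σ' (boolPair pre acc))))).length ≤ Pc.eval (boolPair prm α).length) :
    chainFn pkF sgF Pc (boolPair (boolPair prm α) σ) =
      encList (σ :: chainG (fun L => pkF (boolPair prm L)) (fun L m => sgF (boolPair prm (boolPair L m))) α [] σ) := by
  have hrun : chainRun pkF sgF Pc (boolPair (boolPair prm α) σ) =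
      boolPair (boolPair prm α) (boolPair [] (boolPair [] (boolPair σ (encList (chainItems (fun L => pkF (boolPair prm L))
        (fun L m => sgF (boolPair prm (boolPair L m))) [] σ))))) := by
    rw [chainRun, Function.comp_apply, chainInit]
    simp only [fanoutFn_apply, fstF_boolPair, sndF_boolPair, Function.comp_apply, lenBinF_apply]
    rw [loopX_apply _ _ _ hσ, loopModel_chainBody pkF sgF Pc _ hshort σ [] [] (by simpa using hσ)]
    simp
  rw [chainFn]
  simp only [fanoutFn_apply, sndF_boolPair, fstF_boolPair, Function.comp_apply, appF_boolPair, hrun]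
  rw [chainG, encList_cons, encList_append, encList_singleton]
  simp [nthF, sndPow]

end Loop

/-! ### The node functions of the scheme -/

section Scheme

variable (P : Spec)

/-- The `SigOWF` wrapper context of `S` (irrelevant coin bound). [folklore] -/
noncomputable def ctx : SigOWF.Ctx := ⟨P.S, 0⟩

/-- `F` as a string function: `⟨u, ⟨k, x⟩⟩ ↦ F |u| k x`. [Goldreich 2001, Def. 3.6.3] [folklore] -/
def Ffn (z : List Bool) : List Bool := P.F (fstF z).length (fstF (sndF z)) (sndF (sndF z))

/-- `Ffn` on a record. [folklore] -/
@[simp] theorem Ffn_boolPair (u k x : List Bool) : Ffn P (boolPair u (boolPair k x)) = P.F u.length k x := by simp [Ffn]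

/-- `Ffn ∈ FP` for an efficiently computable ensemble. [Goldreich 2001, Def. 3.6.3; Arora–Barak 2009, §1.3] [folklore] -/
theorem Ffn_mem_FP (hF : PolyTimeComputable (fun p : ℕ × List Bool × List Bool => boolPair (unaryEncodeNat p.1) (boolPair p.2.1 p.2.2))
    (id : List Bool → List Bool) (fun p => P.F p.1 p.2.1 p.2.2)) : Ffn P ∈ FP := by
  have hnorm : fanoutFn (onesFn ∘ fstF) (fanoutFn (fstF ∘ sndF) (sndF ∘ sndF)) ∈ FP :=
    fanoutFn_mem_FP (comp_mem_FP onesFn_mem_FP fstF_mem_FP) (fanoutFn_mem_FP (comp_mem_FP fstF_mem_FP sndF_mem_FP) (comp_mem_FP sndF_mem_FP sndF_mem_FP))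
  have hdec : PolyTimeComputable (id : List Bool → List Bool) (fun p : ℕ × List Bool × List Bool => boolPair (unaryEncodeNat p.1) (boolPair p.2.1 p.2.2))
      (fun z : List Bool => ((fstF z).length, fstF (sndF z), sndF (sndF z))) := by
    obtain ⟨p, M, hM⟩ := hnorm
    refine ⟨p, M, fun z => ?_⟩
    have h := hM z
    simp only [id, fanoutFn_apply, Function.comp_apply, onesFn] at h ⊢
    exact h
  obtain ⟨p, M, hM⟩ := PolyTimeComputable.comp_holds hF hdec
  exact ⟨p, M, fun z => hM z⟩

/-- The block of a label: `⟨s, L⟩ ↦ F n k (code n L)` with `n = |fstF s|`, `k = sndF s` (`s = ⟨1ⁿ, k⟩` the signing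
key). [Goldreich 2004, Construction 6.4.16 ("`f_r(·, x)`")] [cite: Goldreich2004, Construction 6.4.16] -/
noncomputable def blkF : List Bool → List Bool :=
  Ffn P ∘ fanoutFn (fstF ∘ fstF) (fanoutFn (sndF ∘ fstF) (pad10Fn ∘ fanoutFn (onesFn ∘ fstF ∘ fstF) sndF))

/-- `pad10Fn ⟨1ⁿ, L⟩ = code n L`. [folklore] -/
theorem pad10Fn_onesFn (u L : List Bool) : pad10Fn (boolPair (onesFn u) L) = code u.length L := by
  rw [onesFn, Complexity.unaryEncodeNat_eq_replicate]
  exact pad10Fn_boolPair u.length L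

/-- `blkF` on a record. [folklore] -/
theorem blkF_apply (s L : List Bool) : blkF P (boolPair s L) = P.F (fstF s).length (sndF s) (code (fstF s).length L) := by
  simp only [blkF, Function.comp_apply, fanoutFn_apply, fstF_boolPair, sndF_boolPair, pad10Fn_onesFn, Ffn_boolPair]

/-- `blkF ⟨⟨1ⁿ, k⟩, L⟩ = blk n k L`. [folklore] -/
theorem blkF_key (n : ℕ) (k L : List Bool) : blkF P (boolPair (boolPair (ones n) k) L) = blk P n k L := by
  rw [blkF_apply, fstF_boolPair, sndF_boolPair, List.length_replicate]; rfl

/-- `blkF ∈ FP`. [folklore] -/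
theorem blkF_mem_FP (hF : PolyTimeComputable (fun p : ℕ × List Bool × List Bool => boolPair (unaryEncodeNat p.1) (boolPair p.2.1 p.2.2))
    (id : List Bool → List Bool) (fun p => P.F p.1 p.2.1 p.2.2)) : blkF P ∈ FP :=
  comp_mem_FP (Ffn_mem_FP P hF) (fanoutFn_mem_FP (comp_mem_FP fstF_mem_FP fstF_mem_FP) (fanoutFn_mem_FP (comp_mem_FP sndF_mem_FP fstF_mem_FP)
    (comp_mem_FP pad10Fn_mem_FP (fanoutFn_mem_FP (comp_mem_FP onesFn_mem_FP (comp_mem_FP fstF_mem_FP fstF_mem_FP)) sndF_mem_FP))))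

/-! The node functions below are written against an arbitrary BLOCK SOURCE `bF ⟨s, L⟩` (the block of the node `L`
under the parameters `s`, whose first field is `1ⁿ`): the scheme uses `bF = blkF P` (blocks from the seed read off
`s = ⟨1ⁿ, k⟩`), the security reductions read the blocks off a table carried in `s`. -/

variable (bF : List Bool → List Bool)

/-- The coded key pair of a node: `⟨s, L⟩ ↦ ⟨pk, sk⟩ = G(1ⁿ; block ↾ pG(n))`, `n = |fstF s|`. [Goldreich 2004,
Construction 6.4.16 (step 2)] [cite: Goldreich2004, Construction 6.4.16] -/
noncomputable def keyF : List Bool → List Bool :=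
  SigOWF.kgFn (ctx P) ∘ fanoutFn (fstF ∘ fstF) (takeFn ∘ fanoutFn (polyFn P.pG ∘ fstF ∘ fstF) bF)

/-- `keyF` on a record. [folklore] -/
theorem keyF_apply (s L : List Bool) : keyF P bF (boolPair s L) = pairCode (keyOf P (fstF s).length (bF (boolPair s L))) := by
  simp only [keyF, Function.comp_apply, fanoutFn_apply, fstF_boolPair, SigOWF.kgFn_boolPair, polyFn_apply, takeFn_boolPair,
    List.length_replicate]
  rfl

/-- `keyF ∈ FP`. [folklore] -/
theorem keyF_mem_FP (hb : bF ∈ FP) (hK : P.S.keyGen.IsPolyTime unaryEncodeNat pairCode) : keyF P bF ∈ FP :=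
  comp_mem_FP (SigOWF.kgFn_mem_FP (P := ctx P) hK.1) (fanoutFn_mem_FP (comp_mem_FP fstF_mem_FP fstF_mem_FP)
    (comp_mem_FP takeFn_mem_FP (fanoutFn_mem_FP (comp_mem_FP (polyFn_mem_FP _) (comp_mem_FP fstF_mem_FP fstF_mem_FP)) hb)))

/-- `fstF ⟨pk, sk⟩ = pk`. [folklore] -/
@[simp] theorem fstF_pairCode (p : List Bool × List Bool) : fstF (pairCode p) = p.1 := by
  obtain ⟨a, b⟩ := p; exact fstF_boolPair a b

/-- `sndF ⟨pk, sk⟩ = sk`. [folklore] -/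
@[simp] theorem sndF_pairCode (p : List Bool × List Bool) : sndF (pairCode p) = p.2 := by
  obtain ⟨a, b⟩ := p; exact sndF_boolPair a b

/-- The verification key of a node: `⟨s, L⟩ ↦ pk`. [Goldreich 2004, Construction 6.4.16] [cite: Goldreich2004, Construction 6.4.16] -/
noncomputable def pkF₀ : List Bool → List Bool := fstF ∘ keyF P bF

/-- `pkF₀` on a record. [folklore] -/
theorem pkF₀_apply (s L : List Bool) : pkF₀ P bF (boolPair s L) = pkOf P (fstF s).length (bF (boolPair s L)) := by
  rw [pkF₀, Function.comp_apply, keyF_apply, fstF_pairCode]; rfl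

/-- `pkF₀ ∈ FP`. [folklore] -/
theorem pkF₀_mem_FP (hb : bF ∈ FP) (hK : P.S.keyGen.IsPolyTime unaryEncodeNat pairCode) : pkF₀ P bF ∈ FP :=
  comp_mem_FP fstF_mem_FP (keyF_mem_FP P bF hb hK)

/-- The label record `⟨s, L⟩` inside a signing record `⟨s, ⟨L, m⟩⟩`. [folklore] -/
noncomputable def sLab : List Bool → List Bool := fanoutFn fstF (fstF ∘ sndF)
/-- The inner signing key and message `⟨sk, m⟩`. [folklore] -/
noncomputable def sSkm : List Bool → List Bool := fanoutFn (sndF ∘ keyF P bF ∘ sLab) (sndF ∘ sndF)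
/-- The raw signing coins `(block ⇂ pG(n)) ↾ CS(n)`. [folklore] -/
noncomputable def sRaw : List Bool → List Bool :=
  takeFn ∘ fanoutFn (polyFn P.CS ∘ fstF ∘ fstF) (dropFn ∘ fanoutFn (polyFn P.pG ∘ fstF ∘ fstF) (bF ∘ sLab))
/-- The target coin length `1^{pS(|⟨sk, m⟩|)}`. [folklore] -/
noncomputable def sTgt : List Bool → List Bool := polyFn P.pS ∘ sSkm P bF
/-- The fitted coins `raw ↾ t ++ 0^{t - |raw|}`. [folklore] -/
noncomputable def sFit : List Bool → List Bool :=
  appF ∘ fanoutFn (takeFn ∘ fanoutFn (sTgt P bF) (sRaw P bF)) (Kannan.zerosFn ∘ dropFn ∘ fanoutFn (sRaw P bF) (sTgt P bF))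

/-- The one-time signature at a node: `⟨s, ⟨L, m⟩⟩ ↦ signOf n (block L) m`. [Goldreich 2004, Construction 6.4.16
(step 3)] [cite: Goldreich2004, Construction 6.4.16] -/
noncomputable def sgF₀ : List Bool → List Bool := SigOWF.signFn (ctx P) ∘ fanoutFn (sSkm P bF) (sFit P bF)

/-- `fitLen` as take-then-pad. [folklore] -/
theorem fitLen_eq (w : List Bool) (m : ℕ) : fitLen w m = w.take m ++ List.replicate (m - w.length) false := rfl

/-- `sgF₀` on a record. [folklore] -/
theorem sgF₀_apply (s L m : List Bool) : sgF₀ P bF (boolPair s (boolPair L m)) = signOf P (fstF s).length (bF (boolPair s L)) m := by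
  have hskm : sSkm P bF (boolPair s (boolPair L m)) = boolPair (skOf P (fstF s).length (bF (boolPair s L))) m := by
    simp only [sSkm, sLab, Function.comp_apply, fanoutFn_apply, fstF_boolPair, sndF_boolPair, keyF_apply, sndF_pairCode]
    rfl
  have hraw : sRaw P bF (boolPair s (boolPair L m)) = ((bF (boolPair s L)).drop (P.pG.eval (fstF s).length)).take (P.CS.eval (fstF s).length) := by
    simp only [sRaw, sLab, Function.comp_apply, fanoutFn_apply, fstF_boolPair, sndF_boolPair, polyFn_apply, takeFn_boolPair, dropFn_boolPair,
      List.length_replicate]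
  have htgt : sTgt P bF (boolPair s (boolPair L m)) = ones (P.pS.eval (pairCode (skOf P (fstF s).length (bF (boolPair s L)), m)).length) := by
    rw [sTgt, Function.comp_apply, hskm, polyFn_apply]; rfl
  have hfit : sFit P bF (boolPair s (boolPair L m)) = coinsOf P (fstF s).length (bF (boolPair s L)) m := by
    simp only [sFit, Function.comp_apply, fanoutFn_apply, appF_boolPair, takeFn_boolPair, dropFn_boolPair, hraw, htgt, List.length_replicate,
      Kannan.zerosFn_apply, List.length_drop, coinsOf, fitLen_eq]
  rw [sgF₀, Function.comp_apply, fanoutFn_apply, hskm, hfit, SigOWF.signFn_boolPair]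
  rfl

/-- `sgF₀ ∈ FP`. [folklore] -/
theorem sgF₀_mem_FP (hb : bF ∈ FP) (hK : P.S.keyGen.IsPolyTime unaryEncodeNat pairCode)
    (hSg : P.S.sign.IsPolyTime pairCode (id : List Bool → List Bool)) : sgF₀ P bF ∈ FP := by
  have hlab : sLab ∈ FP := fanoutFn_mem_FP fstF_mem_FP (comp_mem_FP fstF_mem_FP sndF_mem_FP)
  have hskm : sSkm P bF ∈ FP := fanoutFn_mem_FP (comp_mem_FP sndF_mem_FP (comp_mem_FP (keyF_mem_FP P bF hb hK) hlab)) (comp_mem_FP sndF_mem_FP sndF_mem_FP)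
  have hraw : sRaw P bF ∈ FP := comp_mem_FP takeFn_mem_FP (fanoutFn_mem_FP (comp_mem_FP (polyFn_mem_FP _) (comp_mem_FP fstF_mem_FP fstF_mem_FP))
    (comp_mem_FP dropFn_mem_FP (fanoutFn_mem_FP (comp_mem_FP (polyFn_mem_FP _) (comp_mem_FP fstF_mem_FP fstF_mem_FP)) (comp_mem_FP hb hlab))))
  have htgt : sTgt P bF ∈ FP := comp_mem_FP (polyFn_mem_FP _) hskm
  have hfit : sFit P bF ∈ FP := comp_mem_FP appF_mem_FP (fanoutFn_mem_FP (comp_mem_FP takeFn_mem_FP (fanoutFn_mem_FP htgt hraw))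
    (comp_mem_FP Kannan.zerosFn_mem_FP (comp_mem_FP dropFn_mem_FP (fanoutFn_mem_FP hraw htgt))))
  exact comp_mem_FP (SigOWF.signFn_mem_FP (P := ctx P) hSg.1) (fanoutFn_mem_FP hskm hfit)

/-- **The chain over `(pkF₀, sgF₀)` is the block-based chain of the specification** read off the block source.
[Goldreich 2004, Construction 6.4.16] [folklore] -/
theorem chainG_pkF₀_sgF₀ (s α σ : List Bool) :
    chainG (fun L => pkF₀ P bF (boolPair s L)) (fun L m => sgF₀ P bF (boolPair s (boolPair L m))) α [] σ =
      chain P (fstF s).length α (bF (boolPair s [])) σ ((pathLabels σ).map fun L => bF (boolPair s L)) := by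
  rw [pathLabels, chain_eq_chainG P (fstF s).length (fun L => bF (boolPair s L)) α [] σ]
  simp only [pkF₀_apply, sgF₀_apply]

variable {bF}

/-! ### The signing algorithm is polynomial-time -/

/-- The signing algorithm as a string function: `⟨⟨s, α⟩, ρ⟩ ↦ chainFn ⟨⟨s, α⟩, ρ ↾ |fstF s|⟩`.
[Goldreich 2004, Construction 6.4.16] [cite: Goldreich2004, Construction 6.4.16] -/
noncomputable def signFnT (Pc : Polynomial ℕ) : List Bool → List Bool :=
  chainFn (pkF₀ P (blkF P)) (sgF₀ P (blkF P)) Pc ∘ fanoutFn fstF (takeFn ∘ fanoutFn (fstF ∘ fstF ∘ fstF) sndF)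

/-- `signFnT ∈ FP`. [folklore] -/
theorem signFnT_mem_FP (hF : PolyTimeComputable (fun p : ℕ × List Bool × List Bool => boolPair (unaryEncodeNat p.1) (boolPair p.2.1 p.2.2))
    (id : List Bool → List Bool) (fun p => P.F p.1 p.2.1 p.2.2)) (hK : P.S.keyGen.IsPolyTime unaryEncodeNat pairCode)
    (hSg : P.S.sign.IsPolyTime pairCode (id : List Bool → List Bool)) (Pc : Polynomial ℕ) : signFnT P Pc ∈ FP :=
  comp_mem_FP (chainFn_mem_FP _ _ Pc (pkF₀_mem_FP P _ (blkF_mem_FP P hF) hK) (sgF₀_mem_FP P _ (blkF_mem_FP P hF) hK hSg))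
    (fanoutFn_mem_FP fstF_mem_FP (comp_mem_FP takeFn_mem_FP (fanoutFn_mem_FP (comp_mem_FP fstF_mem_FP (comp_mem_FP fstF_mem_FP fstF_mem_FP)) sndF_mem_FP)))

/-- **Semantics of `signFnT`** (clip large enough on the genuine pieces): the value on `⟨⟨s, α⟩, ρ⟩` is
`sigOf n (sndF s) α (ρ ↾ n)`, `n = |fstF s|` — the signing algorithm of the scheme. [Goldreich 2004, Construction
6.4.16] [folklore] -/
theorem signFnT_apply {Pc : Polynomial ℕ} (s α ρ : List Bool)
    (hshort : ∀ (cnt σ' pre acc : List Bool), pre.length + σ'.length ≤ (boolPair s α).length →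
      (pieceZ (pkF₀ P (blkF P)) (sgF₀ P (blkF P)) (boolPair (boolPair s α) (boolPair cnt (boolPair σ' (boolPair pre acc))))).length ≤
        Pc.eval (boolPair s α).length) :
    signFnT P Pc (boolPair (boolPair s α) ρ) = (signT P).run (s, α) ρ := by
  have hσ : (ρ.take (fstF s).length).length ≤ (boolPair s α).length := by
    have := length_fstF_sndF_le s
    simp only [List.length_take, length_boolPair]; omega
  rw [signFnT, Function.comp_apply]
  simp only [fanoutFn_apply, fstF_boolPair, sndF_boolPair, Function.comp_apply, takeFn_boolPair]
  rw [chainFn_apply _ _ Pc s α _ hσ hshort, chainG_pkF₀_sgF₀]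
  simp only [blkF_apply]
  rfl

end Scheme

/-! ### Polynomial time of the three algorithms -/

section PolyTime

variable (P : Spec)

/-- **The signing algorithm of the tree scheme is PPT** (for efficient `F`, `G`, `S`): the genuine pieces met by
the loop are bounded by a polynomial of the yardstick (output-length bounds of `pkF₀`, `sgF₀`), so the clipped loop
computes `S'`. [Goldreich 2004, Construction 6.4.16 ("polynomial-time")] [cite: Goldreich2004, Construction 6.4.16] -/
theorem signT_isPolyTime (hF : PolyTimeComputable (fun p : ℕ × List Bool × List Bool => boolPair (unaryEncodeNat p.1) (boolPair p.2.1 p.2.2))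
    (id : List Bool → List Bool) (fun p => P.F p.1 p.2.1 p.2.2)) (hK : P.S.keyGen.IsPolyTime unaryEncodeNat pairCode)
    (hSg : P.S.sign.IsPolyTime pairCode (id : List Bool → List Bool)) : (signT P).IsPolyTime pairCode (id : List Bool → List Bool) := by
  obtain ⟨s₁, hs₁⟩ := exists_poly_length_le_of_mem_FP' (pkF₀_mem_FP P _ (blkF_mem_FP P hF) hK)
  obtain ⟨s₂, hs₂⟩ := exists_poly_length_le_of_mem_FP' (sgF₀_mem_FP P _ (blkF_mem_FP P hF) hK hSg)
  -- bounds on the genuine pieces, polynomial in the yardstick `x = ⟨s, α⟩`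
  set A : Polynomial ℕ := s₁.comp (3 * X + 3) with hA
  set B : Polynomial ℕ := s₂.comp (4 * X + 3 * A + 6) with hB
  set Pc : Polynomial ℕ := 4 * A + 2 * B + 6 with hPc
  have hpk : ∀ (sk α pre : List Bool) (b : Bool), pre.length ≤ (boolPair sk α).length →
      (pkF₀ P (blkF P) (boolPair sk (pre ++ [b]))).length ≤ A.eval (boolPair sk α).length := by
    intro sk α pre b hpre
    refine (hs₁ _).trans ?_
    rw [hA, eval_comp]
    refine TM2Iter.eval_mono s₁ ?_
    simp only [length_boolPair, List.length_append, List.length_singleton, eval_add, eval_mul, eval_ofNat, eval_X] at hpre ⊢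
    omega
  have hshort : ∀ (sk α cnt σ' pre acc : List Bool), pre.length + σ'.length ≤ (boolPair sk α).length →
      (pieceZ (pkF₀ P (blkF P)) (sgF₀ P (blkF P)) (boolPair (boolPair sk α) (boolPair cnt (boolPair σ' (boolPair pre acc))))).length ≤ Pc.eval (boolPair sk α).length := by
    intro sk α cnt σ' pre acc hle
    have hpre : pre.length ≤ (boolPair sk α).length := le_trans (Nat.le_add_right _ _) hle
    have h0 := hpk sk α pre false hpre
    have h1 := hpk sk α pre true hpre
    have hsg : (sgF₀ P (blkF P) (boolPair sk (boolPair pre (boolPair (pkF₀ P (blkF P) (boolPair sk (pre ++ [false]))) (pkF₀ P (blkF P) (boolPair sk (pre ++ [true]))))))).length ≤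
        B.eval (boolPair sk α).length := by
      refine (hs₂ _).trans ?_
      rw [hB, eval_comp]
      refine TM2Iter.eval_mono s₂ ?_
      simp only [length_boolPair, eval_add, eval_mul, eval_ofNat, eval_X] at hpre h0 h1 ⊢
      nlinarith
    rw [pieceZ_apply, fstF_boolPair]
    simp only [encList_cons, encList_nil, length_boolPair, List.length_nil, hPc, eval_add, eval_mul, eval_ofNat] at h0 h1 hsg ⊢
    omega
  refine ⟨(signFnT_mem_FP P hF hK hSg Pc).of_encode (fun p : (List Bool × List Bool) × List Bool => boolPair (pairCode p.1) p.2)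
    (fun _ => rfl) fun p => ?_, X, fun n => by simp [signT]⟩
  obtain ⟨⟨sk, α⟩, ρ⟩ := p
  exact signFnT_apply P sk α ρ (hshort sk α)

/-! #### Key generation -/

/-- `1ⁿ` read off `⟨1ⁿ, k⟩` (normalised). [folklore] -/
noncomputable def guF : List Bool → List Bool := onesFn ∘ fstF
/-- The root key `pk_ε`. [folklore] -/
noncomputable def gpkF : List Bool → List Bool := pkF₀ P (blkF P) ∘ fanoutFn (fanoutFn guF sndF) fun _ => []
/-- `1^{PK(n) - |pk_ε|}`. [folklore] -/
noncomputable def gwF : List Bool → List Bool := dropFn ∘ fanoutFn (gpkF P) (polyFn P.PK ∘ fstF)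

/-- `G'` as a string function on `⟨1ⁿ, k⟩`: `⟨⟨1ⁿ, ⟨pk_ε, 0^{2(PK(n)-|pk_ε|)}⟩⟩, ⟨1ⁿ, k⟩⟩`. [Goldreich 2004,
Construction 6.4.16 (key generation)] [cite: Goldreich2004, Construction 6.4.16] -/
noncomputable def kgFnT : List Bool → List Bool :=
  fanoutFn (fanoutFn guF (fanoutFn (gpkF P) (Kannan.zerosFn ∘ appF ∘ fanoutFn (gwF P) (gwF P)))) (fanoutFn guF sndF)

/-- `kgFnT` computes `G'`. [folklore] -/
theorem kgFnT_apply (n : ℕ) (k : List Bool) : kgFnT P (boolPair (unaryEncodeNat n) k) = pairCode ((keyGenT P).run n k) := by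
  have hu : guF (boolPair (unaryEncodeNat n) k) = ones n := by
    simp [guF, onesFn, Complexity.unaryEncodeNat_eq_replicate]
  have hpk : gpkF P (boolPair (unaryEncodeNat n) k) = pkOf P n (blk P n k []) := by
    rw [gpkF, Function.comp_apply, fanoutFn_apply, fanoutFn_apply, hu, sndF_boolPair, pkF₀_apply, fstF_boolPair, blkF_apply, fstF_boolPair, sndF_boolPair,
      List.length_replicate]
    rfl
  have hw : gwF P (boolPair (unaryEncodeNat n) k) = ones (P.PK.eval n - (pkOf P n (blk P n k [])).length) := by
    rw [gwF, Function.comp_apply, fanoutFn_apply, hpk, Function.comp_apply, fstF_boolPair, polyFn_apply, dropFn_boolPair,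
      Complexity.unaryEncodeNat_eq_replicate, List.length_replicate]
    simp [ones, List.drop_replicate]
  rw [kgFnT, fanoutFn_apply, fanoutFn_apply, fanoutFn_apply, fanoutFn_apply, hu, hpk, sndF_boolPair]
  simp only [Function.comp_apply, fanoutFn_apply, hw, appF_boolPair, Kannan.zerosFn_apply, List.length_append, List.length_replicate]
  have hrhs : pairCode ((keyGenT P).run n k) = boolPair (boolPair (ones n) (padPk P n (pkOf P n (blk P n k [])))) (boolPair (ones n) k) := rfl
  rw [hrhs, padPk, two_mul]

/-- `kgFnT ∈ FP`. [folklore] -/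
theorem kgFnT_mem_FP (hF : PolyTimeComputable (fun p : ℕ × List Bool × List Bool => boolPair (unaryEncodeNat p.1) (boolPair p.2.1 p.2.2))
    (id : List Bool → List Bool) (fun p => P.F p.1 p.2.1 p.2.2)) (hK : P.S.keyGen.IsPolyTime unaryEncodeNat pairCode) : kgFnT P ∈ FP := by
  have hu : guF ∈ FP := comp_mem_FP onesFn_mem_FP fstF_mem_FP
  have hpk : gpkF P ∈ FP := comp_mem_FP (pkF₀_mem_FP P _ (blkF_mem_FP P hF) hK) (fanoutFn_mem_FP (fanoutFn_mem_FP hu sndF_mem_FP) (const_mem_FP _))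
  have hw : gwF P ∈ FP := comp_mem_FP dropFn_mem_FP (fanoutFn_mem_FP hpk (comp_mem_FP (polyFn_mem_FP _) fstF_mem_FP))
  exact fanoutFn_mem_FP (fanoutFn_mem_FP hu (fanoutFn_mem_FP hpk (comp_mem_FP Kannan.zerosFn_mem_FP (comp_mem_FP appF_mem_FP (fanoutFn_mem_FP hw hw)))))
    (fanoutFn_mem_FP hu sndF_mem_FP)

/-- **Key generation of the tree scheme is PPT** (coin budget `κ`, polynomially bounded by hypothesis).
[Goldreich 2004, Construction 6.4.16] [cite: Goldreich2004, Construction 6.4.16] -/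
theorem keyGenT_isPolyTime (hF : PolyTimeComputable (fun p : ℕ × List Bool × List Bool => boolPair (unaryEncodeNat p.1) (boolPair p.2.1 p.2.2))
    (id : List Bool → List Bool) (fun p => P.F p.1 p.2.1 p.2.2)) (hK : P.S.keyGen.IsPolyTime unaryEncodeNat pairCode)
    (hκ : ∃ q : Polynomial ℕ, ∀ n, P.κ n ≤ q.eval n) : (keyGenT P).IsPolyTime unaryEncodeNat pairCode := by
  refine ⟨(kgFnT_mem_FP P hF hK).of_encode (fun p : ℕ × List Bool => boolPair (unaryEncodeNat p.1) p.2) (fun _ => rfl) fun p => ?_, hκ⟩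
  exact kgFnT_apply P p.1 p.2

/-! #### Verification -/

/-- The verifier's walk as a function returning the final key, the unread items and the conjunction of the
level checks. [Goldreich 2004, Construction 6.4.14 (`V'`)] [cite: Goldreich2004, Construction 6.4.14] -/
def walk : List Bool → List Bool → List Bool → List Bool × List Bool × Bool
  | key, [], rest => (key, rest, true)
  | key, b :: σ, rest =>
    ((walk (if b then nthF 1 rest else nthF 0 rest) σ (sndPow 2 rest)).1,
      (walk (if b then nthF 1 rest else nthF 0 rest) σ (sndPow 2 rest)).2.1,
      P.S.verify key (boolPair (nthF 0 rest) (nthF 1 rest)) (nthF 2 rest) && (walk (if b then nthF 1 rest else nthF 0 rest) σ (sndPow 2 rest)).2.2)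

/-- `checkChain` in terms of the walk: all level checks and the leaf check. [folklore] -/
theorem checkChain_eq_walk (α : List Bool) : ∀ key σ rest : List Bool,
    checkChain P α key σ rest = ((walk P key σ rest).2.2 && P.S.verify (walk P key σ rest).1 α (nthF 0 (walk P key σ rest).2.1))
  | key, [], rest => by simp [checkChain, walk]
  | key, b :: σ, rest => by
    rw [checkChain, walk, checkChain_eq_walk α _ σ _]
    simp only [Bool.and_assoc]

/-- The one-time verifier as a one-bit string function. [folklore] -/
noncomputable def vF : List Bool → List Bool := SigOWF.verFn (ctx P)

/-- `vF` is one-bit. [folklore] -/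
theorem oneBit_vF : OneBit (vF P) := fun _ => ⟨_, rfl⟩

/-- `vF` on a record. [folklore] -/
@[simp] theorem vF_boolPair (pk m sg : List Bool) : vF P (boolPair pk (boolPair m sg)) = [P.S.verify pk m sg] := by
  rw [vF, SigOWF.verFn_boolPair]; rfl

/-- The first symbol (default `0`), as a one-bit string function. [folklore] -/
noncomputable def hdF : List Bool → List Bool := (PRelSigma.headT true).eval

/-- `hdF u = [u.headD 0]`. [folklore] -/
@[simp] theorem hdF_apply (u : List Bool) : hdF u = [u.headD false] := by
  rw [hdF, PRelSigma.headT_eval]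
  cases u with
  | nil => rfl
  | cons b u => cases b <;> rfl

/-- `hdF` is one-bit. [folklore] -/
theorem oneBit_hdF : OneBit hdF := fun u => ⟨_, hdF_apply u⟩

/-- `hdF ∈ FP`. [folklore] -/
theorem hdF_mem_FP : hdF ∈ FP := (PRelSigma.headT true).polyTimeComputable_eval

/-- **The body of the verifier's loop** on `⟨x, ⟨cnt, ⟨σ', ⟨key, ⟨rest, flag⟩⟩⟩⟩⟩`: check this level, move to the claimed
key of the child on the path, drop the three items, accumulate the flag. [Goldreich 2004, Construction 6.4.14 (`V'`)]
[cite: Goldreich2004, Construction 6.4.14] -/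
noncomputable def verBody : List Bool → List Bool :=
  fanoutFn (dropFn ∘ fanoutFn (fun _ => [true]) (nthF 2))
    (fanoutFn (iteFn (hdF ∘ nthF 2) (nthF 1 ∘ nthF 4) (nthF 0 ∘ nthF 4))
      (fanoutFn (sndPow 2 ∘ nthF 4)
        (andFn (hdF ∘ sndPow 4) (vF P ∘ fanoutFn (nthF 3) (fanoutFn (fanoutFn (nthF 0 ∘ nthF 4) (nthF 1 ∘ nthF 4)) (nthF 2 ∘ nthF 4))))))

/-- `verBody` on a record with a nonempty bit source and a one-bit flag. [folklore] -/
theorem verBody_apply (x cnt key rest : List Bool) (b f : Bool) (σ' : List Bool) :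
    verBody P (boolPair x (boolPair cnt (boolPair (b :: σ') (boolPair key (boolPair rest [f]))))) =
      boolPair σ' (boolPair (if b then nthF 1 rest else nthF 0 rest) (boolPair (sndPow 2 rest)
        [f && P.S.verify key (boolPair (nthF 0 rest) (nthF 1 rest)) (nthF 2 rest)])) := by
  have hc : (hdF ∘ nthF 2) (boolPair x (boolPair cnt (boolPair (b :: σ') (boolPair key (boolPair rest [f]))))) = [b] := by
    simp [nthF]
  have hv : (vF P ∘ fanoutFn (nthF 3) (fanoutFn (fanoutFn (nthF 0 ∘ nthF 4) (nthF 1 ∘ nthF 4)) (nthF 2 ∘ nthF 4)))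
      (boolPair x (boolPair cnt (boolPair (b :: σ') (boolPair key (boolPair rest [f]))))) =
      [P.S.verify key (boolPair (nthF 0 rest) (nthF 1 rest)) (nthF 2 rest)] := by
    simp [nthF]
  have hf : (hdF ∘ sndPow 4) (boolPair x (boolPair cnt (boolPair (b :: σ') (boolPair key (boolPair rest [f]))))) = [f] := by simp [sndPow]
  rw [verBody, fanoutFn_apply, fanoutFn_apply, fanoutFn_apply, iteFn_apply hc, andFn_apply hf hv]
  cases b <;> simp [nthF, sndPow]

/-- `verBody ∈ FP`. [folklore] -/
theorem verBody_mem_FP (hV : PolyTimeComputable SignatureScheme.verifyCode encodeBool (fun p : List Bool × List Bool × List Bool => P.S.verify p.1 p.2.1 p.2.2)) :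
    verBody P ∈ FP :=
  fanoutFn_mem_FP (comp_mem_FP dropFn_mem_FP (fanoutFn_mem_FP (const_mem_FP _) (nthF_mem_FP 2)))
    (fanoutFn_mem_FP (iteFn_mem_FP (comp_mem_FP hdF_mem_FP (nthF_mem_FP 2)) (comp_mem_FP (nthF_mem_FP 1) (nthF_mem_FP 4)) (comp_mem_FP (nthF_mem_FP 0) (nthF_mem_FP 4)))
      (fanoutFn_mem_FP (comp_mem_FP (sndPow_mem_FP 2) (nthF_mem_FP 4))
        (andFn_mem_FP (comp_mem_FP hdF_mem_FP (sndPow_mem_FP 4)) (comp_mem_FP (SigOWF.verFn_mem_FP (P := ctx P) hV) (fanoutFn_mem_FP (nthF_mem_FP 3)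
          (fanoutFn_mem_FP (fanoutFn_mem_FP (comp_mem_FP (nthF_mem_FP 0) (nthF_mem_FP 4)) (comp_mem_FP (nthF_mem_FP 1) (nthF_mem_FP 4)))
            (comp_mem_FP (nthF_mem_FP 2) (nthF_mem_FP 4))))))))

/-- **The verifier's loop does not grow the state** (beyond the flag bit): `≤ |state| + 9`. [folklore] -/
theorem length_verBody_le (z : List Bool) : (verBody P z).length ≤ (sndPow 1 z).length + (9 : Polynomial ℕ).eval (fstF z).length := by
  set rest := nthF 4 z with hrest
  have h1 : 2 * (nthF 2 z).length + (sndPow 2 z).length ≤ (sndPow 1 z).length := length_nthF_succ_add_sndPow_succ_le 1 z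
  have h2 : 2 * (nthF 3 z).length + (sndPow 3 z).length ≤ (sndPow 2 z).length := length_nthF_succ_add_sndPow_succ_le 2 z
  have h3 : 2 * rest.length + (sndPow 4 z).length ≤ (sndPow 3 z).length := length_nthF_succ_add_sndPow_succ_le 3 z
  have r0 : 2 * (nthF 0 rest).length + (sndPow 0 rest).length ≤ rest.length := by
    simpa [nthF, sndPow] using length_fstF_sndF_le rest
  have r1 : 2 * (nthF 1 rest).length + (sndPow 1 rest).length ≤ (sndPow 0 rest).length := length_nthF_succ_add_sndPow_succ_le 0 rest
  have r2 : 2 * (nthF 2 rest).length + (sndPow 2 rest).length ≤ (sndPow 1 rest).length := length_nthF_succ_add_sndPow_succ_le 1 rest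
  have hd : (dropFn (fanoutFn (fun _ => [true]) (nthF 2) z)).length ≤ (nthF 2 z).length := by
    rw [fanoutFn_apply, dropFn_boolPair]; simp
  have hk : (iteFn (hdF ∘ nthF 2) (nthF 1 ∘ nthF 4) (nthF 0 ∘ nthF 4) z).length ≤ max (nthF 1 rest).length (nthF 0 rest).length := by
    rw [iteFn_of_oneBit (oneBit_hdF.comp _)]
    split_ifs
    · exact le_max_left _ _
    · exact le_max_right _ _
  have ha : (andFn (hdF ∘ sndPow 4) (vF P ∘ fanoutFn (nthF 3) (fanoutFn (fanoutFn (nthF 0 ∘ nthF 4) (nthF 1 ∘ nthF 4)) (nthF 2 ∘ nthF 4))) z).length = 1 :=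
    (oneBit_andFn (oneBit_hdF.comp _) ((oneBit_vF P).comp _)).length_eq z
  have hlen : (verBody P z).length = 2 * (dropFn (fanoutFn (fun _ => [true]) (nthF 2) z)).length + 2 +
      (2 * (iteFn (hdF ∘ nthF 2) (nthF 1 ∘ nthF 4) (nthF 0 ∘ nthF 4) z).length + 2 +
        (2 * (sndPow 2 rest).length + 2 +
          (andFn (hdF ∘ sndPow 4) (vF P ∘ fanoutFn (nthF 3) (fanoutFn (fanoutFn (nthF 0 ∘ nthF 4) (nthF 1 ∘ nthF 4)) (nthF 2 ∘ nthF 4))) z).length)) := by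
    simp only [verBody, fanoutFn_apply, Function.comp_apply, length_boolPair, hrest]
  rw [hlen, eval_ofNat, ha]
  have hm : max (nthF 1 rest).length (nthF 0 rest).length + (sndPow 2 rest).length ≤ rest.length := by
    rcases le_total (nthF 1 rest).length (nthF 0 rest).length with h | h
    · rw [max_eq_right h]; omega
    · rw [max_eq_left h]; omega
  omega

/-- **The loop computes the walk.** [Goldreich 2004, Construction 6.4.14 (`V'`)] [folklore] -/
theorem loopModel_verBody (x : List Bool) : ∀ (σ key rest : List Bool) (f : Bool),
    loopModel (verBody P) x σ.length (boolPair σ (boolPair key (boolPair rest [f]))) =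
      boolPair [] (boolPair (walk P key σ rest).1 (boolPair (walk P key σ rest).2.1 [f && (walk P key σ rest).2.2]))
  | [], key, rest, f => by simp [loopModel, walk]
  | b :: σ, key, rest, f => by
    rw [List.length_cons, loopModel, verBody_apply, loopModel_verBody x σ _ _ _, walk]
    simp only [Bool.and_assoc]

/-- The initial record of the verifier's loop, from `w = ⟨pk', ⟨α, sig⟩⟩`:
`⟨w, ⟨bin |σ|, ⟨σ, ⟨pk_ε, ⟨items, 1⟩⟩⟩⟩⟩`. [folklore] -/
noncomputable def verInit : List Bool → List Bool :=
  fanoutFn id (fanoutFn (lenBinF ∘ fstF ∘ sndPow 1) (fanoutFn (fstF ∘ sndPow 1) (fanoutFn (fstF ∘ sndF ∘ fstF)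
    (fanoutFn (sndF ∘ sndPow 1) fun _ => [true]))))

/-- The run of the verifier's loop. [folklore] -/
noncomputable def verRun : List Bool → List Bool := loopX (verBody P) ∘ verInit

/-- **`V'` as a string function** on `⟨pk', ⟨α, sig⟩⟩`: `[|σ| = n] ∧ (all level checks) ∧ V(key_n, α, β_n)`.
[Goldreich 2004, Construction 6.4.14 / 6.4.16 (`V'`)] [cite: Goldreich2004, Construction 6.4.14] -/
noncomputable def verFnT : List Bool → List Bool :=
  andFn (eqPairFn ∘ fanoutFn (onesFn ∘ fstF ∘ sndPow 1) (onesFn ∘ fstF ∘ fstF))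
    (andFn (hdF ∘ sndPow 4 ∘ verRun P) (vF P ∘ fanoutFn (nthF 3 ∘ verRun P) (fanoutFn (nthF 1) (nthF 0 ∘ nthF 4 ∘ verRun P))))

/-- `verFnT ∈ FP`. [folklore] -/
theorem verFnT_mem_FP (hV : PolyTimeComputable SignatureScheme.verifyCode encodeBool (fun p : List Bool × List Bool × List Bool => P.S.verify p.1 p.2.1 p.2.2)) :
    verFnT P ∈ FP := by
  have hinit : verInit ∈ FP :=
    fanoutFn_mem_FP id_mem_FP (fanoutFn_mem_FP (comp_mem_FP lenBinF_mem_FP (comp_mem_FP fstF_mem_FP (sndPow_mem_FP 1)))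
      (fanoutFn_mem_FP (comp_mem_FP fstF_mem_FP (sndPow_mem_FP 1)) (fanoutFn_mem_FP (comp_mem_FP fstF_mem_FP (comp_mem_FP sndF_mem_FP fstF_mem_FP))
        (fanoutFn_mem_FP (comp_mem_FP sndF_mem_FP (sndPow_mem_FP 1)) (const_mem_FP _)))))
  have hb : verBody P ∈ FP := verBody_mem_FP P hV
  have hg : ∀ z, (verBody P z).length ≤ (sndPow 1 z).length + (9 : Polynomial ℕ).eval (fstF z).length := length_verBody_le P
  have hrun : verRun P ∈ FP := comp_mem_FP (loopX_mem_FP hb hg) hinit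
  have hv : vF P ∈ FP := SigOWF.verFn_mem_FP (P := ctx P) hV
  exact andFn_mem_FP (comp_mem_FP eqPairFn_mem_FP (fanoutFn_mem_FP (comp_mem_FP onesFn_mem_FP (comp_mem_FP fstF_mem_FP (sndPow_mem_FP 1)))
      (comp_mem_FP onesFn_mem_FP (comp_mem_FP fstF_mem_FP fstF_mem_FP))))
    (andFn_mem_FP (comp_mem_FP hdF_mem_FP (comp_mem_FP (sndPow_mem_FP 4) hrun)) (comp_mem_FP hv (fanoutFn_mem_FP (comp_mem_FP (nthF_mem_FP 3) hrun)
      (fanoutFn_mem_FP (nthF_mem_FP 1) (comp_mem_FP (nthF_mem_FP 0) (comp_mem_FP (nthF_mem_FP 4) hrun))))))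

/-- **Semantics of `verFnT`**: `[V'(pk', α, sig)]`. [Goldreich 2004, Construction 6.4.14 / 6.4.16] [folklore] -/
theorem verFnT_apply (pkT α sig : List Bool) : verFnT P (boolPair pkT (boolPair α sig)) = [verifyT P pkT α sig] := by
  set w := boolPair pkT (boolPair α sig) with hw
  have hσ : (fstF sig).length ≤ w.length := by
    have h1 := length_fstF_sndF_le sig
    rw [hw, length_boolPair, length_boolPair]; omega
  have hrun : verRun P w = boolPair w (boolPair [] (boolPair [] (boolPair (walk P (fstF (sndF pkT)) (fstF sig) (sndF sig)).1
      (boolPair (walk P (fstF (sndF pkT)) (fstF sig) (sndF sig)).2.1 [(walk P (fstF (sndF pkT)) (fstF sig) (sndF sig)).2.2])))) := by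
    rw [verRun, Function.comp_apply, verInit]
    simp only [fanoutFn_apply, Function.comp_apply, id, hw, sndPow_succ_boolPair, sndPow_zero_boolPair, fstF_boolPair, lenBinF_apply]
    rw [← hw, loopX_apply _ _ _ hσ, loopModel_verBody]
    simp
  have hlen : (eqPairFn ∘ fanoutFn (onesFn ∘ fstF ∘ sndPow 1) (onesFn ∘ fstF ∘ fstF)) w = [decide ((fstF sig).length = (fstF pkT).length)] := by
    simp only [Function.comp_apply, fanoutFn_apply, hw, sndPow_succ_boolPair, sndPow_zero_boolPair, fstF_boolPair, eqPairFn_boolPair, onesFn,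
      Complexity.unaryEncodeNat_eq_replicate]
    simp [List.replicate_inj]
  have hflag : (hdF ∘ sndPow 4 ∘ verRun P) w = [(walk P (fstF (sndF pkT)) (fstF sig) (sndF sig)).2.2] := by
    rw [Function.comp_apply, Function.comp_apply, hrun]; simp [sndPow]
  have hleaf : (vF P ∘ fanoutFn (nthF 3 ∘ verRun P) (fanoutFn (nthF 1) (nthF 0 ∘ nthF 4 ∘ verRun P))) w =
      [P.S.verify (walk P (fstF (sndF pkT)) (fstF sig) (sndF sig)).1 α (nthF 0 (walk P (fstF (sndF pkT)) (fstF sig) (sndF sig)).2.1)] := by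
    simp only [Function.comp_apply, fanoutFn_apply, hrun]
    simp [nthF, hw]
  rw [verFnT, andFn_apply hlen (andFn_apply hflag hleaf), verifyT, checkChain_eq_walk]

/-- **Verification of the tree scheme is polynomial-time.** [Goldreich 2004, Construction 6.4.16] [cite: Goldreich2004, Construction 6.4.16] -/
theorem verifyT_polyTime (hV : PolyTimeComputable SignatureScheme.verifyCode encodeBool (fun p : List Bool × List Bool × List Bool => P.S.verify p.1 p.2.1 p.2.2)) :
    PolyTimeComputable SignatureScheme.verifyCode encodeBool (fun p : List Bool × List Bool × List Bool => verifyT P p.1 p.2.1 p.2.2) :=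
  (verFnT_mem_FP P hV).of_encode SignatureScheme.verifyCode (fun _ => rfl) fun p => verFnT_apply P p.1 p.2.1 p.2.2

/-- **Construction 6.4.16 is efficient** whenever the one-time scheme `S` is efficient, `F` is an efficiently computable
ensemble at the lengths used, and the seed length `κ` is polynomially bounded. [Goldreich 2004, Construction 6.4.16]
[cite: Goldreich2004, Construction 6.4.16] -/
theorem isEfficient (hS : P.S.IsEfficient)
    (hF : PolyTimeComputable (fun p : ℕ × List Bool × List Bool => boolPair (unaryEncodeNat p.1) (boolPair p.2.1 p.2.2))
      (id : List Bool → List Bool) (fun p => P.F p.1 p.2.1 p.2.2))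
    (hκ : ∃ q : Polynomial ℕ, ∀ n, P.κ n ≤ q.eval n) : (scheme P).IsEfficient :=
  ⟨keyGenT_isPolyTime P hF hS.1 hκ, signT_isPolyTime P hF hS.1 hS.2.1, verifyT_polyTime P hS.2.2⟩

/-- The same from `IsEfficientFamily F κ ℓin ℓout` (any length functions). [Goldreich 2001, Def. 3.6.3] [folklore] -/
theorem isEfficient_of_isEfficientFamily (hS : P.S.IsEfficient) {ℓin ℓout : ℕ → ℕ} (hF : IsEfficientFamily P.F P.κ ℓin ℓout) :
    (scheme P).IsEfficient := by
  obtain ⟨q, hq⟩ := hF.2.1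
  exact isEfficient P hS hF.1 ⟨q, fun n => (hq n).1⟩

end PolyTime

end TreeSig

end Literature.Computability.Cryptography
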